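import Mathlib
import Summits.NavierStokesRegularity.NavierStokesRegularity.Theorems.ThreadingFluxHorizonTowerQuadraticGeneratorAxis
import Summits.NavierStokesRegularity.NavierStokesRegularity.Theorems.ThreadingFluxHorizonTowerQuadraticGeneratorChart
import Literature.Algebra.Polynomial.FischerHarmonicNormalForm
import HarnessLib

/-!
# Crux `PoloidalLiouville` (stmt-NavierStokesRegularity-1222), crux idea «horizon-threading-tower» (ns-idea-15):
# THE TOWER `{2, 4, 6}` — THE THREE `ρ`-ADIC DIGITS OF ITS ORDER-ONE CLASS IDENTITY

Support file (`--supports stmt-NavierStokesRegularity-1222`, helper; cell `ns-wall-extremal`, width hand ns-wall-eng-3 g5; 0 kit), toward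
THM E «the finite tower `{2, 4, 6}` is coaxially zonal at order one».  Real coefficients.

★★ `exists_genM_eq_of_classIdentity`: let `P₂ ∈ 𝓗₂` (any real harmonic quadratic), `P₄ = c₁ A(Q)`, `P₆ = c₂ B(Q)` (`A = 35·π₄(L²)`,
`B = 77·π₆(L³)`, `L = xᵀQx ≠ 0` the quadratic generator, `c₁ c₂ ≠ 0`) satisfy the order-one class identity of the tower
`7ρ²{P₂,P₄} + 18ρ{P₂,P₆} + 11{P₄,P₆} = 0`.  Then `|Qx|² = β·xᵀQx + γ·|x|²` for some reals `β, γ` — i.e. `Q² = βQ + γI`, `Q` has at most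
two distinct eigenvalues, and (uniaxial lemma, `…QuadraticGeneratorAxis`) `L` is zonal.  PROOF (the digits):
* digit 1 is automatic (`{A, B}` has a factor `ρ`, `detP_genA_genB`);
* digit 2: after division by `ρ`, the null-cone chart of the identity reads `(chartT L)² · chartT F = 0` with the real cubic
  `F = 4158 c₂ {P₂, L} − 13860 c₁c₂ {L, M}`; `chartT L ≠ 0` (chart injective on harmonics), so `chartT F = 0`, so `F = ρ · c` with `c` a
  linear form (harmonic Fischer decomposition `𝒫₃ = 𝓗₃ ⊕ ρ𝒫₁`, Literature `exists_harmonic_add_sum_sq_mul_of_isHomogeneous`, plus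
  injectivity); `F` vanishes at the three principal axes of `Q` (both brackets do: `∇L(b_k) ∥ b_k`), hence so does `c`, hence `c = 0`,
  hence `F = 0`: `{L, P₂ + (10c₁/3) M₀} = 0` (`M₀ = M − (τ/3)ρ`), and SAME-DEGREE BRACKET RIGIDITY (p684047, `l = 2`) gives
  `P₂ = σ L − (10c₁/3) M + κ ρ`;
* digit 3: the closed form `classIdentity_span` with `θ = −10c₁/3` has `k₁ = 0` and leaves `ρ²W · (k_L L + k_M M + k₀ ρ) = 0` with
  `k_M = −94080 c₁c₂ ≠ 0`; if `W = det(x,Qx,Q²x) ≠ 0` this is the claim, and if `W = 0` then `{L, M₀} = 0` and same-degree rigidity gives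
  `M₀ ∥ L` directly.

HONEST LABEL: algebra about one crux idea's typed objects; no Prop of the sketch is closed here; `HorizonTowerZonality` (general
towers), `PoloidalLiouville` (1222) OPEN; NS regularity NOT proved.  [folklore]
-/

-- the summit and its single sub-problem share the name (CONVENTIONS §1)
set_option linter.dupNamespace false

noncomputable section

open MvPolynomial
open scoped RealInnerProductSpace
open Literature.Analysis.FluidPDE (cross)
open Literature.Geometry.DiscreteGeometry (inner_fin3 norm_sq_fin3)

namespace Summit.NavierStokesRegularity.NavierStokesRegularity.Theorems.PoloidalLiouville.HorizonTower.Zonal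

/-! ### Small tools -/

/-- The bracket of two quadratics is a cubic. [folklore] -/
theorem isHomogeneous_detP_two_two {A B : RPoly} (hA : A.IsHomogeneous 2) (hB : B.IsHomogeneous 2) :
    (detP A B).IsHomogeneous 3 := by
  have hdA : ∀ i : Fin 3, (pderiv i A).IsHomogeneous 1 := fun i => by simpa using hA.pderiv (i := i)
  have hdB : ∀ i : Fin 3, (pderiv i B).IsHomogeneous 1 := fun i => by simpa using hB.pderiv (i := i)
  unfold detP
  exact isHomogeneous_X_comb (((hdA 1).mul (hdB 2)).sub ((hdA 2).mul (hdB 1)))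
    (((hdA 2).mul (hdB 0)).sub ((hdA 0).mul (hdB 2))) (((hdA 0).mul (hdB 1)).sub ((hdA 1).mul (hdB 0)))

/-- `lapP p = 0` in the functional form used by `LoopLaw.sameDegreeBracketRigidity`. [folklore] -/
theorem laplacian_eval_eq_zero_of_lapP {p : RPoly} (h : lapP p = 0) (y : E3) :
    Laplacian.laplacian (fun y : E3 => MvPolynomial.eval (fun i => y i) p) y = 0 := by
  change Laplacian.laplacian (evalE p) y = 0
  rw [laplacian_evalE, h, evalE_zero]

/-- `detP A B = 0` in the functional form used by `LoopLaw.sameDegreeBracketRigidity`. [folklore] -/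
theorem bracket_eval_eq_zero_of_detP {A B : RPoly} (h : detP A B = 0) (y : E3) :
    ⟪y, cross (gradient (fun y : E3 => MvPolynomial.eval (fun i => y i) A) y)
      (gradient (fun y : E3 => MvPolynomial.eval (fun i => y i) B) y)⟫ = 0 := by
  change ⟪y, cross (gradient (evalE A) y) (gradient (evalE B) y)⟫ = 0
  rw [LoopLaw.loopBracket_evalE, h, evalE_zero]

/-- ★ **A real cubic that dies on the null cone is `ρ` times a linear form** (harmonic Fischer decomposition + chart injectivity).
[folklore] -/
theorem exists_eq_normSq_mul_of_chartT_eq_zero {F : RPoly} (hF : F.IsHomogeneous 3)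
    (hchart : chartT (map (algebraMap ℝ ℂ) F) = 0) : ∃ c : RPoly, c.IsHomogeneous 1 ∧ F = normSq * c := by
  obtain ⟨h, c, hh, hΔ, hc, hF'⟩ :=
    Literature.Algebra.Polynomial.FischerDecomposition.exists_harmonic_add_sum_sq_mul_of_isHomogeneous (ι := Fin 3) hF
  have hlap : lapP h = 0 := by rw [Fin.sum_univ_three] at hΔ; exact hΔ
  have hρ : (∑ i : Fin 3, X i ^ 2 : RPoly) = normSq := by rw [Fin.sum_univ_three]; rfl
  rw [hρ] at hF'
  have hh0 : h = 0 := by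
    refine eq_zero_of_chartT_map_eq_zero hh hlap ?_
    have := hchart
    rw [hF', map_add, map_mul, map_normSq, chartT_add, chartT_mul, chartT_normSq, zero_mul, add_zero] at this
    exact this
  refine ⟨c, by simpa using hc, ?_⟩
  rw [hF', hh0, zero_add]

/-! ### The digits -/

/-- ★★ **THE DIGITS OF THE TOWER `{2, 4, 6}`.**  If a real harmonic quadratic `P₂`, `P₄ = c₁·A(Q)`, `P₆ = c₂·B(Q)` (`c₁c₂ ≠ 0`, generator
`L = xᵀQx ≠ 0`) satisfy the order-one class identity `7ρ²{P₂,P₄} + 18ρ{P₂,P₆} + 11{P₄,P₆} = 0`, then `|Qx|² = β xᵀQx + γ |x|²` for some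
reals `β, γ`. [folklore] -/
theorem exists_genM_eq_of_classIdentity {P₂ : RPoly} {a b d e f c₁ c₂ : ℝ} (hP₂ : P₂.IsHomogeneous 2) (hP₂l : lapP P₂ = 0)
    (hc₁ : c₁ ≠ 0) (hc₂ : c₂ ≠ 0) (hL : genL a b d e f ≠ 0)
    (hE : C 7 * normSq ^ 2 * detP P₂ (C c₁ * genA a b d e f) + C 18 * normSq * detP P₂ (C c₂ * genB a b d e f)
      + C 11 * detP (C c₁ * genA a b d e f) (C c₂ * genB a b d e f) = 0) :
    ∃ β γ : ℝ, genM a b d e f = C β * genL a b d e f + C γ * normSq := by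
  have hρ0 : (normSq : RPoly) ≠ 0 := rho_ne_zero
  -- the harmonic companion `M₀ = M − (τ/3) ρ` of `M`
  set M₀ : RPoly := genM a b d e f - C (genTau a b d e f / 3) * normSq with hM₀
  have hM₀h : M₀.IsHomogeneous 2 := (isHomogeneous_genM a b d e f).sub (isHomogeneous_normSq.C_mul _)
  have hM₀l : lapP M₀ = 0 := by
    rw [hM₀, lapP_sub, lapP_C_mul, lapP_genM, lapP_normSq, ← map_mul, ← map_sub,
      show 2 * genTau a b d e f - genTau a b d e f / 3 * 6 = 0 by ring, map_zero]
  have hLh : (genL a b d e f).IsHomogeneous 2 ∧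
      ∀ y : E3, Laplacian.laplacian (fun y : E3 => MvPolynomial.eval (fun i => y i) (genL a b d e f)) y = 0 :=
    ⟨isHomogeneous_genL a b d e f, laplacian_eval_eq_zero_of_lapP (lapP_genL a b d e f)⟩
  by_cases hW : genW a b d e f = 0
  · -- `{L, M₀} = 0`: same-degree rigidity
    have hbr : detP (genL a b d e f) M₀ = 0 := by
      rw [hM₀, detP_sub_right, detP_C_mul_right, detP_normSq_right, mul_zero, sub_zero, detP_genL_genM, hW, mul_zero]
    obtain ⟨c, hc⟩ := LoopLaw.sameDegreeBracketRigidity 2 (genL a b d e f) M₀ (by norm_num) hLh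
      ⟨hM₀h, laplacian_eval_eq_zero_of_lapP hM₀l⟩ hL (bracket_eval_eq_zero_of_detP hbr)
    refine ⟨c, genTau a b d e f / 3, ?_⟩
    rw [← smul_eq_C_mul, ← hc, hM₀]
    ring
  · -- (1) divide the class identity by `ρ`
    rw [classIdentity_expand] at hE
    have hT := (mul_eq_zero.mp hE).resolve_left hρ0
    -- the cubic `F`
    set F : RPoly := C (4158 * c₂) * detP P₂ (genL a b d e f) - C (13860 * c₁ * c₂) * detP (genL a b d e f) (genM a b d e f)
      with hFdef
    have hF3 : F.IsHomogeneous 3 :=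
      ((isHomogeneous_detP_two_two hP₂ (isHomogeneous_genL a b d e f)).C_mul _).sub
        ((isHomogeneous_detP_two_two (isHomogeneous_genL a b d e f) (isHomogeneous_genM a b d e f)).C_mul _)
    have hT0 : C (4158 * c₂) * genL a b d e f ^ 2 * detP P₂ (genL a b d e f)
        - C (55440 * c₁ * c₂) * genL a b d e f ^ 2 * genW a b d e f = genL a b d e f ^ 2 * F := by
      have h4 : C (55440 * c₁ * c₂) * genL a b d e f ^ 2 * genW a b d e f
          = C (13860 * c₁ * c₂) * genL a b d e f ^ 2 * (C 4 * genW a b d e f) := by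
        simp only [map_mul, map_ofNat]; ring
      rw [h4, ← detP_genL_genM, hFdef]
      ring
    rw [hT0] at hT
    -- (2) the chart of the identity: `(chartT L)² · chartT F = 0`
    have hFchart : chartT (map (algebraMap ℝ ℂ) F) = 0 := by
      have h1 := congrArg (fun p : RPoly => chartT (map (algebraMap ℝ ℂ) p)) hT
      simp only [map_add, map_mul, map_pow, map_normSq, chartT_add, chartT_mul, chartT_pow, chartT_normSq, zero_mul,
        add_zero, map_zero, chartT_zero, zero_pow (two_ne_zero)] at h1
      have hLc : chartT (map (algebraMap ℝ ℂ) (genL a b d e f)) ≠ 0 := fun h0 =>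
        hL (eq_zero_of_chartT_map_eq_zero (isHomogeneous_genL a b d e f) (lapP_genL a b d e f) h0)
      exact (mul_eq_zero.mp h1).resolve_left (pow_ne_zero 2 hLc)
    -- (3) Fischer: `F = ρ · c`, `c` linear
    obtain ⟨c, hc1, hFc⟩ := exists_eq_normSq_mul_of_chartT_eq_zero hF3 hFchart
    -- (4) `c` vanishes at the principal axes of `Q`, hence `c = 0`, hence `F = 0`
    have hc0 : c = 0 := by
      refine eq_zero_of_isHomogeneous_one_of_eval_eigenvectorBasis a b d e f hc1 fun k => ?_
      have hv := genMat_mulVec_eigenvectorBasis a b d e f k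
      have hFk : evalE F ((genMat_isHermitian a b d e f).eigenvectorBasis k) = 0 := by
        rw [hFdef, evalE_sub, evalE_mul, evalE_mul, evalE_detP_genL_of_eigen a b d e f P₂ hv,
          evalE_detP_genL_left_of_eigen a b d e f _ hv, mul_zero, mul_zero, sub_zero]
      rw [hFc, evalE_mul, evalE_normSq, (genMat_isHermitian a b d e f).eigenvectorBasis.orthonormal.1 k, one_pow,
        one_mul] at hFk
      exact hFk
    have hF0 : F = 0 := by rw [hFc, hc0, mul_zero]
    -- (5) `{L, P₂ + (10c₁/3) M₀} = 0` and same-degree rigidity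
    set P₂' : RPoly := P₂ + C (10 * c₁ / 3) * M₀ with hP₂'
    have hbr : detP (genL a b d e f) P₂' = 0 := by
      have hkey : C (4158 * c₂) * detP (genL a b d e f) P₂' = 0 := by
        rw [hP₂', detP_add_right, detP_C_mul_right, hM₀, detP_sub_right, detP_C_mul_right, detP_normSq_right, mul_zero,
          sub_zero, Zonal.detP_antisymm P₂ (genL a b d e f)]
        rw [hFdef] at hF0
        simp only [map_mul, map_ofNat] at hF0 ⊢
        have h3 : (3 : RPoly) * C (10 * c₁ / 3) = 10 * C c₁ := by
          rw [show (3 : RPoly) = C 3 from (map_ofNat C 3).symm, ← map_mul,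
            show (3 : ℝ) * (10 * c₁ / 3) = 10 * c₁ by ring, map_mul, map_ofNat]
        linear_combination (-1 : RPoly) * hF0 + (1386 * C c₂ * detP (genL a b d e f) (genM a b d e f)) * h3
      have hC : (C (4158 * c₂) : RPoly) ≠ 0 := by rw [Ne, C_eq_zero]; exact mul_ne_zero (by norm_num) hc₂
      exact (mul_eq_zero.mp hkey).resolve_left hC
    obtain ⟨σ, hσ⟩ := LoopLaw.sameDegreeBracketRigidity 2 (genL a b d e f) P₂' (by norm_num) hLh
      ⟨hP₂.add (hM₀h.C_mul _), laplacian_eval_eq_zero_of_lapP (by rw [hP₂', lapP_add, lapP_C_mul, hP₂l, hM₀l, mul_zero,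
        add_zero])⟩ hL (bracket_eval_eq_zero_of_detP hbr)
    have hP₂eq : P₂ = C σ * genL a b d e f + C (-(10 * c₁ / 3)) * genM a b d e f
        + C (10 * c₁ / 3 * (genTau a b d e f / 3)) * normSq := by
      have h1 : P₂ = P₂' - C (10 * c₁ / 3) * M₀ := by rw [hP₂']; ring
      rw [h1, hσ, smul_eq_C_mul, hM₀]
      simp only [map_neg, map_mul]
      ring
    -- (6) digit 3: the closed form on the span
    have hE' : C 7 * normSq ^ 2 * detP P₂ (C c₁ * genA a b d e f) + C 18 * normSq * detP P₂ (C c₂ * genB a b d e f)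
        + C 11 * detP (C c₁ * genA a b d e f) (C c₂ * genB a b d e f) = 0 := by
      rw [classIdentity_expand]; exact hE
    rw [hP₂eq, classIdentity_span] at hE'
    set kL : ℝ := -(1960 * c₁ * (-(10 * c₁ / 3))) - 6048 * c₂ * σ with hkL
    set kM : ℝ := 6048 * c₂ * (-(10 * c₁ / 3)) - 73920 * c₁ * c₂ with hkM
    set k0 : ℝ := -(560 * c₁ * σ) - 1008 * genTau a b d e f * c₂ * (-(10 * c₁ / 3))
      + 12320 * genTau a b d e f * c₁ * c₂ with hk0
    have hk1 : (-(16632 * c₂ * (-(10 * c₁ / 3))) - 55440 * c₁ * c₂ : ℝ) = 0 := by ring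
    rw [hk1, C_0, zero_mul, zero_mul, zero_mul, zero_add] at hE'
    have hfac : normSq ^ 2 * genW a b d e f * (C kL * genL a b d e f + C kM * genM a b d e f + C k0 * normSq) = 0 := by
      rw [← hE']; ring
    have h0 : C kL * genL a b d e f + C kM * genM a b d e f + C k0 * normSq = 0 :=
      (mul_eq_zero.mp hfac).resolve_left (mul_ne_zero (pow_ne_zero 2 hρ0) hW)
    have hkM0 : kM ≠ 0 := by
      have : kM = -94080 * c₁ * c₂ := by rw [hkM]; ring
      rw [this]; exact mul_ne_zero (mul_ne_zero (by norm_num) hc₁) hc₂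
    refine ⟨-kL * kM⁻¹, -k0 * kM⁻¹, ?_⟩
    have hM' : genM a b d e f = C kM⁻¹ * (C kM * genM a b d e f) := by
      rw [← mul_assoc, ← map_mul, inv_mul_cancel₀ hkM0, map_one, one_mul]
    rw [hM', show C kM * genM a b d e f = -(C kL * genL a b d e f) - C k0 * normSq by linear_combination h0]
    simp only [map_mul, map_neg]
    ring

end Summit.NavierStokesRegularity.NavierStokesRegularity.Theorems.PoloidalLiouville.HorizonTower.Zonal

end
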